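import Summits.CriticalPhenomena.CardyFormulaZ2.Theorems.CardyMeckeFlipLawToCrossingsLowerPrelims
import HarnessLib

/-!
# A crossing of the harder quad of `R` by the open edges is a crude crossing of `R`

Support file for item `LawToCrossings` (stmt-CriticalPhenomena-14828) of route `CardyMeckeFlip`,
sub-problem `CardyFormulaZ2`: first step of the LOWER half of the bridge between the
Schramm–Smirnov encoding `ω ↦ S_ω ∈ ℋ_ℂ` and the crude embedded crossing event.

Let `Φ` be a square model of `R`, `H = rotI.trans Φ`, `Q_{a,b} = rectQuad H a b`; the quad
`Q⁺ = Q_{1+s,1-s}` is LONGER (it pokes out of `Ω̄` across the arcs `0, 2`) and NARROWER (it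
stays away from the arcs `1, 3`) than the quad `Q_{1,1}` of `R`, hence harder.

* `crossed_subset_crude` — **for `δ < δ₀(R, s)`, `Q⁺ ∈ S_ω` forces the crude event**: `Q⁺ ∈ S_ω`
  gives a crossing `K` of the slightly easier `Q_{1+s/2,1-s/2}` inside the open edges
  (`Quad.exists_isCrossing_of_mem_closure`); in the graph of open edges through `K`
  (`reachable_of_mem_edgePairs`), walk from an edge near side `0` (outside `Ω̄`, near `R.arc 0`) to
  an edge near side `2`; the first exit of the walk from the vertices "outside near arc `0`, or
  inside and joined inside `Ω` to such a vertex" produces an open path with all vertices in `Ω`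
  from within `δ` of `R.arc 0` to within `δ` of `R.arc 2` (edges of the walk cannot reach the arcs
  `1, 3`, nor join the two far sides).

References: O. Schramm, S. Smirnov, Ann. Probab. 39 (2011), §1.3; B. Bollobás, O. Riordan,
*Percolation* (2006), Ch. 7 (comparison domains).
-/

noncomputable section

open Set Filter MeasureTheory Metric Complex
open scoped Topology unitInterval ENNReal
open Literature.Probability.Percolation Literature.Probability.Percolation.QuadCrossing
open Literature.Probability.RandomPlanarGeometry Literature.Probability.LatticeModels
open Literature.Topology.PlaneTopology

namespace Summit.CriticalPhenomena.CardyFormulaZ2.Theorems.MeckeFlipBridge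

section SquareModel

variable {R : ConformalRectangle} {Φ : ℂ ≃ₜ ℂ} (h : IsSquareModel R Φ)
include h

/-- **`Q⁺ ∈ S_ω` forces the crude crossing event, for small mesh.**  For `s ∈ (0, 1/2]` there is
`δ₀ > 0` such that for `0 < δ < δ₀` and every configuration `ω` with
`Q_{1+s,1-s} = rectQuad H (1 + s) (1 - s) ∈ S_ω`, some vertex with mesh point in `Ω` within `δ`
of `R.arc 0` is joined to some vertex with mesh point in `Ω` within `δ` of `R.arc 2` by an open
path all of whose vertices have their mesh points in `Ω`. -/
theorem crossed_subset_crude {s : ℝ} (hs : 0 < s) (hs' : s ≤ 1 / 2) :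
    ∃ δ₀ : ℝ, 0 < δ₀ ∧ ∀ δ : ℝ, 0 < δ → δ < δ₀ → ∀ ω : BondConfig (Site 2),
      Quad.rectQuad ((Homeomorph.mulLeft₀ Complex.I Complex.I_ne_zero).trans Φ) (1 + s) (1 - s)
        (by linarith) (by linarith) (fun _ => mem_univ _) ∈ z2QuadConfig univ δ ω →
      ω ∈ openCrossing {x : Site 2 | meshPoint δ x ∈ R.carrier}
        {u | infDist (meshPoint δ u) (R.arc 0) ≤ δ}
        {v | infDist (meshPoint δ v) (R.arc 2) ≤ δ} := by
  classical
  set H : ℂ ≃ₜ ℂ := (Homeomorph.mulLeft₀ Complex.I Complex.I_ne_zero).trans Φ with hH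
  set t : ℝ := s / 2 with ht
  have ht0 : 0 < t := by positivity
  have ht1 : t < 1 := by rw [ht]; linarith
  -- the slightly easier long-and-narrow quad `Q' = Q_{1+t,1-t} < Q⁺`
  have hlt : Quad.StrictlyDominated
      (Quad.rectQuad H (1 + t) (1 - t) (by linarith) (by linarith) (fun _ => mem_univ _))
      (Quad.rectQuad H (1 + s) (1 - s) (by linarith) (by linarith) (fun _ => mem_univ _)) :=
    Quad.strictlyDominated_rectQuad H (by linarith) (by rw [ht]; linarith) (by linarith)
      (by rw [ht]; linarith) _ _
  -- the compact pieces: far-left `AL`, far-right `AR`, the band `B`, its outer sides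
  set AL : Set ℂ := H '' (Icc (-2 : ℝ) (-1) ×ℂ Icc (-2 : ℝ) 2) with hAL
  set AR : Set ℂ := H '' (Icc (1 : ℝ) 2 ×ℂ Icc (-2 : ℝ) 2) with hAR
  set B : Set ℂ := H '' (Icc (-(1 + t)) (1 + t) ×ℂ Icc (-(1 - t)) (1 - t)) with hB
  set Sd : Set ℂ := H '' {w : ℂ | (w.re = -(1 + t) ∨ w.re = 1 + t) ∧ w.im ∈ Icc (-(1 - t)) (1 - t)}
    with hSd
  have hALc : IsCompact AL := (isCompact_Icc.reProdIm isCompact_Icc).image H.continuous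
  have hARc : IsCompact AR := (isCompact_Icc.reProdIm isCompact_Icc).image H.continuous
  have hBc : IsCompact B := (isCompact_Icc.reProdIm isCompact_Icc).image H.continuous
  have hSdc : IsCompact Sd := by
    have : {w : ℂ | (w.re = -(1 + t) ∨ w.re = 1 + t) ∧ w.im ∈ Icc (-(1 - t)) (1 - t)} =
        ({-(1 + t)} ×ℂ Icc (-(1 - t)) (1 - t)) ∪ ({1 + t} ×ℂ Icc (-(1 - t)) (1 - t)) := by
      ext w; simp only [mem_setOf_eq, mem_union, mem_reProdIm, mem_singleton_iff]; tauto
    rw [hSd, this]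
    exact ((isCompact_singleton.reProdIm isCompact_Icc).union
      (isCompact_singleton.reProdIm isCompact_Icc)).image H.continuous
  -- (1) far-left and far-right are at positive distance `dLR`
  obtain ⟨dLR, hdLR, hLR⟩ : ∃ d : ℝ, 0 < d ∧ ∀ a ∈ AL, ∀ b ∈ AR, d < dist a b := by
    refine exists_pos_forall_lt_dist_of_disjoint hALc hARc.isClosed ?_
    rw [hAL, hAR, disjoint_iff_forall_ne]
    rintro _ ⟨w, hw, rfl⟩ _ ⟨w', hw', rfl⟩ heq
    have := H.injective heq
    subst this
    rw [mem_reProdIm, mem_Icc] at hw hw'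
    linarith [hw.1.2, hw'.1.1]
  -- (2) the band is at positive distance `d13` from the arcs `1`, `3`
  obtain ⟨d13, hd13, h13⟩ : ∃ d : ℝ, 0 < d ∧ ∀ a ∈ B, ∀ b ∈ R.arc 1 ∪ R.arc 3, d < dist a b := by
    refine exists_pos_forall_lt_dist_of_disjoint hBc ((R.isClosed_arc 1).union (R.isClosed_arc 3)) ?_
    rw [hB, ← side_one_quadOf h, ← side_three_quadOf h, side_one_rq, side_three_rq,
      disjoint_iff_forall_ne]
    rintro _ ⟨w, hw, rfl⟩ _ hb heq
    rcases hb with ⟨w', hw', hw'e⟩ | ⟨w', hw', hw'e⟩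
    · have := H.injective (heq.trans hw'e.symm); subst this
      rw [mem_reProdIm, mem_Icc, mem_Icc] at hw
      linarith [hw.2.1, hw'.1]
    · have := H.injective (heq.trans hw'e.symm); subst this
      rw [mem_reProdIm, mem_Icc, mem_Icc] at hw
      linarith [hw.2.2, hw'.1]
  -- (3) the outer sides of the band are at positive distance `dout` from the closed quad
  obtain ⟨dout, hdout, hout⟩ : ∃ d : ℝ, 0 < d ∧ ∀ a ∈ Sd, ∀ b ∈ closure R.carrier, d < dist a b := by
    refine exists_pos_forall_lt_dist_of_disjoint hSdc isClosed_closure ?_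
    rw [hSd, disjoint_iff_forall_ne]
    rintro _ ⟨w, hw, rfl⟩ b hb heq
    rw [← heq] at hb
    have hb' := (apply_mem_closure_iff h w).1 hb
    rw [mem_reProdIm, mem_Icc] at hb'
    rcases hw.1 with h1 | h1 <;> rw [h1] at hb' <;> linarith [hb'.1.1, hb'.1.2]
  -- (4) arcs `0 ⊆ AL`, `2 ⊆ AR`; band minus `Ω` inside `AL ∪ AR`
  have h0AL : R.arc 0 ⊆ AL := by
    rw [← side_zero_quadOf h, side_zero_rq, hAL]
    rintro _ ⟨w, hw, rfl⟩
    refine mem_image_of_mem _ ?_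
    rw [mem_reProdIm, mem_Icc, mem_Icc]
    exact ⟨⟨by linarith [hw.1], by linarith [hw.1]⟩, by linarith [hw.2.1], by linarith [hw.2.2]⟩
  have h2AR : R.arc 2 ⊆ AR := by
    rw [← side_two_quadOf h, side_two_rq, hAR]
    rintro _ ⟨w, hw, rfl⟩
    refine mem_image_of_mem _ ?_
    rw [mem_reProdIm, mem_Icc, mem_Icc]
    exact ⟨⟨by linarith [hw.1], by linarith [hw.1]⟩, by linarith [hw.2.1], by linarith [hw.2.2]⟩
  have hBout : ∀ k ∈ B, k ∉ R.carrier → k ∈ AL ∪ AR := by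
    rintro _ ⟨w, hw, rfl⟩ hk
    rw [apply_mem_carrier_iff h, mem_reProdIm, mem_Ioo, mem_Ioo] at hk
    rw [mem_reProdIm, mem_Icc, mem_Icc] at hw
    have him : -1 < w.im ∧ w.im < 1 := ⟨by linarith [hw.2.1], by linarith [hw.2.2]⟩
    have hre : w.re ≤ -1 ∨ 1 ≤ w.re := by
      by_contra hcon; push Not at hcon; exact hk ⟨⟨hcon.1, hcon.2⟩, him⟩
    rcases hre with hre | hre
    · left; refine mem_image_of_mem _ ?_
      rw [mem_reProdIm, mem_Icc, mem_Icc]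
      exact ⟨⟨by linarith [hw.1.1], hre⟩, by linarith, by linarith⟩
    · right; refine mem_image_of_mem _ ?_
      rw [mem_reProdIm, mem_Icc, mem_Icc]
      exact ⟨⟨hre, by linarith [hw.1.2]⟩, by linarith, by linarith⟩
  have hfr : frontier R.carrier ⊆ R.arc 0 ∪ R.arc 2 ∪ (R.arc 1 ∪ R.arc 3) := by
    intro z hz
    rw [← R.iUnion_arc_holds] at hz
    obtain ⟨i, hi⟩ := mem_iUnion.1 hz
    fin_cases i
    · exact Or.inl (Or.inl hi)
    · exact Or.inr (Or.inl hi)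
    · exact Or.inl (Or.inr hi)
    · exact Or.inr (Or.inr hi)
  -- the mesh threshold
  refine ⟨min (min dLR d13) dout / 4, by positivity, ?_⟩
  intro δ hδ hδlt ω hmem
  have hδLR : 4 * δ < dLR := by
    have := min_le_left (min dLR d13) dout; have := min_le_left dLR d13; linarith
  have hδ13 : 4 * δ < d13 := by
    have := min_le_left (min dLR d13) dout; have := min_le_right dLR d13; linarith
  have hδout : 4 * δ < dout := by
    have := min_le_right (min dLR d13) dout; linarith
  -- a crossing `K` of `Q'` inside the open edges
  set O : Set ℂ := openEdgeUnion δ ω with hO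
  have hmem' : Quad.rectQuad H (1 + s) (1 - s) (by linarith) (by linarith) (fun _ => mem_univ _) ∈
      closure {Q : Quad (univ : Set ℂ) | ∃ K, Q.IsCrossing K ∧ K ⊆ O} := by
    rw [← coe_z2QuadConfig]; exact hmem
  obtain ⟨K, ⟨hKc, hKconn, hKQ, hK0, hK2⟩, hKO⟩ := Quad.exists_isCrossing_of_mem_closure hlt hmem'
  have hKB : K ⊆ B := by rw [hB, ← carrier_rq H]; exact hKQ
  -- points of segments, frontier crossings
  have hseg_le : ∀ {x y : Site 2}, (zdGraph 2).Adj x y →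
      ∀ z ∈ segment ℝ (meshPoint δ x) (meshPoint δ y), dist z (meshPoint δ x) ≤ δ ∧
        dist z (meshPoint δ y) ≤ δ := by
    intro x y hxy z hz
    have hxy' : dist (meshPoint δ x) (meshPoint δ y) = δ := by
      rw [dist_meshPoint_of_adj hxy, abs_of_pos hδ]
    constructor
    · have hsub : segment ℝ (meshPoint δ x) (meshPoint δ y) ⊆ closedBall (meshPoint δ x) δ :=
        (convex_closedBall _ _).segment_subset (mem_closedBall_self hδ.le)
          (by rw [mem_closedBall, dist_comm, hxy'])
      exact mem_closedBall.1 (hsub hz)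
    · have hsub : segment ℝ (meshPoint δ x) (meshPoint δ y) ⊆ closedBall (meshPoint δ y) δ :=
        (convex_closedBall _ _).segment_subset (by rw [mem_closedBall, hxy']) (mem_closedBall_self hδ.le)
      exact mem_closedBall.1 (hsub hz)
  -- KEY: an edge pair of `K` with one end in `Ω` and the other outside crosses `R.arc 0` or
  -- `R.arc 2` within `δ` of both ends (never the arcs `1, 3`: the band is too far from them)
  have hcross : ∀ e ∈ edgePairs δ ω K, meshPoint δ e.1 ∈ R.carrier → meshPoint δ e.2 ∉ R.carrier →
      ∃ f ∈ R.arc 0 ∪ R.arc 2, dist f (meshPoint δ e.1) ≤ δ ∧ dist f (meshPoint δ e.2) ≤ δ := by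
    rintro e ⟨hadj, -, k, hks, hkK⟩ h1 h2
    have hsc : IsPreconnected (segment ℝ (meshPoint δ e.1) (meshPoint δ e.2)) :=
      (convex_segment _ _).isPreconnected
    obtain ⟨f, hfs, hff⟩ := Literature.Algebra.EuclideanLattices.isPreconnected_inter_frontier_nonempty
      hsc ⟨_, left_mem_segment _ _ _, h1⟩ ⟨_, right_mem_segment _ _ _, h2⟩
    obtain ⟨hf1, hf2⟩ := hseg_le hadj f hfs
    refine ⟨f, ?_, hf1, hf2⟩
    rcases hfr hff with hf | hf
    · exact hf
    · exfalso
      have hkf : dist k f ≤ 2 * δ := by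
        have := (hseg_le hadj k hks).1
        calc dist k f ≤ dist k (meshPoint δ e.1) + dist (meshPoint δ e.1) f := dist_triangle _ _ _
          _ ≤ δ + δ := add_le_add this (by rw [dist_comm]; exact hf1)
          _ = 2 * δ := by ring
      have := h13 k (hKB hkK) f hf
      linarith
  -- the `P_{arc}`-distance statements needed for the crude event
  have hnear0 : ∀ e ∈ edgePairs δ ω K, meshPoint δ e.1 ∈ R.carrier → meshPoint δ e.2 ∉ R.carrier →
      infDist (meshPoint δ e.2) AL ≤ δ → infDist (meshPoint δ e.1) (R.arc 0) ≤ δ := by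
    intro e he h1 h2 hL
    obtain ⟨f, hf, hf1, hf2⟩ := hcross e he h1 h2
    rcases hf with hf | hf
    · calc infDist (meshPoint δ e.1) (R.arc 0) ≤ dist (meshPoint δ e.1) f := infDist_le_dist_of_mem hf
        _ ≤ δ := by rw [dist_comm]; exact hf1
    · exfalso
      -- `f ∈ arc 2 ⊆ AR` is within `δ` of `e.2`, itself within `δ` of `AL`
      obtain ⟨a, ha, had⟩ := hALc.exists_infDist_eq_dist ⟨R.pt 0, h0AL (R.pt_mem_arc_self 0)⟩
        (meshPoint δ e.2)
      have h3 := hLR a ha f (h2AR hf)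
      have h4 : dist a f ≤ dist a (meshPoint δ e.2) + dist (meshPoint δ e.2) f := dist_triangle _ _ _
      have h5 : dist a (meshPoint δ e.2) = infDist (meshPoint δ e.2) AL := by rw [had, dist_comm]
      have h6 : dist (meshPoint δ e.2) f ≤ δ := by rw [dist_comm]; exact hf2
      linarith
  have hnear2 : ∀ e ∈ edgePairs δ ω K, meshPoint δ e.1 ∈ R.carrier → meshPoint δ e.2 ∉ R.carrier →
      infDist (meshPoint δ e.2) AR ≤ δ → infDist (meshPoint δ e.1) (R.arc 2) ≤ δ := by
    intro e he h1 h2 hRt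
    obtain ⟨f, hf, hf1, hf2⟩ := hcross e he h1 h2
    rcases hf with hf | hf
    · exfalso
      obtain ⟨a, ha, had⟩ := hARc.exists_infDist_eq_dist ⟨R.pt 2, h2AR (R.pt_mem_arc_self 2)⟩
        (meshPoint δ e.2)
      have h3 := hLR f (h0AL hf) a ha
      have h4 : dist f a ≤ dist f (meshPoint δ e.2) + dist (meshPoint δ e.2) a := dist_triangle _ _ _
      have h5 : dist (meshPoint δ e.2) a = infDist (meshPoint δ e.2) AR := by rw [had]
      linarith
    · calc infDist (meshPoint δ e.1) (R.arc 2) ≤ dist (meshPoint δ e.1) f := infDist_le_dist_of_mem hf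
        _ ≤ δ := by rw [dist_comm]; exact hf1
  -- outside ends of edge pairs are near `AL` or near `AR`
  have houtside : ∀ e ∈ edgePairs δ ω K, meshPoint δ e.2 ∉ R.carrier →
      infDist (meshPoint δ e.2) AL ≤ δ ∨ infDist (meshPoint δ e.2) AR ≤ δ := by
    rintro e he h2
    obtain ⟨hadj, -, k, hks, hkK⟩ := id he
    by_cases hk : k ∈ R.carrier
    · -- the segment from `k ∈ Ω` to `e.2 ∉ Ω` meets an arc `0`/`2` point within `δ` of `e.2`
      have hsc : IsPreconnected (segment ℝ k (meshPoint δ e.2)) := (convex_segment _ _).isPreconnected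
      obtain ⟨f, hfs, hff⟩ := Literature.Algebra.EuclideanLattices.isPreconnected_inter_frontier_nonempty
        hsc ⟨_, left_mem_segment _ _ _, hk⟩ ⟨_, right_mem_segment _ _ _, h2⟩
      have hsub : segment ℝ k (meshPoint δ e.2) ⊆ segment ℝ (meshPoint δ e.1) (meshPoint δ e.2) :=
        (convex_segment _ _).segment_subset hks (right_mem_segment _ _ _)
      obtain ⟨hf1, hf2⟩ := hseg_le hadj f (hsub hfs)
      rcases hfr hff with hf | hf
      · rcases hf with hf | hf
        · left
          calc infDist (meshPoint δ e.2) AL ≤ dist (meshPoint δ e.2) f := infDist_le_dist_of_mem (h0AL hf)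
            _ ≤ δ := by rw [dist_comm]; exact hf2
        · right
          calc infDist (meshPoint δ e.2) AR ≤ dist (meshPoint δ e.2) f := infDist_le_dist_of_mem (h2AR hf)
            _ ≤ δ := by rw [dist_comm]; exact hf2
      · exfalso
        have hkf : dist k f ≤ 2 * δ := by
          have := (hseg_le hadj k hks).1
          calc dist k f ≤ dist k (meshPoint δ e.1) + dist (meshPoint δ e.1) f := dist_triangle _ _ _
            _ ≤ δ + δ := add_le_add this (by rw [dist_comm]; exact hf1)
            _ = 2 * δ := by ring
        have := h13 k (hKB hkK) f hf
        linarith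
    · rcases hBout k (hKB hkK) hk with hk' | hk'
      · left
        calc infDist (meshPoint δ e.2) AL ≤ dist (meshPoint δ e.2) k := infDist_le_dist_of_mem hk'
          _ ≤ δ := by rw [dist_comm]; exact (hseg_le hadj k hks).2
      · right
        calc infDist (meshPoint δ e.2) AR ≤ dist (meshPoint δ e.2) k := infDist_le_dist_of_mem hk'
          _ ≤ δ := by rw [dist_comm]; exact (hseg_le hadj k hks).2
  -- no vertex is near both `AL` and `AR`; no edge joins the two
  have hnotboth : ∀ z : ℂ, infDist z AL ≤ δ → infDist z AR ≤ δ → False := by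
    intro z hzL hzR
    obtain ⟨a, ha, had⟩ := hALc.exists_infDist_eq_dist ⟨R.pt 0, h0AL (R.pt_mem_arc_self 0)⟩ z
    obtain ⟨b, hb, hbd⟩ := hARc.exists_infDist_eq_dist ⟨R.pt 2, h2AR (R.pt_mem_arc_self 2)⟩ z
    have h3 := hLR a ha b hb
    have h4 : dist a b ≤ dist a z + dist z b := dist_triangle _ _ _
    have h5 : dist a z = infDist z AL := by rw [had, dist_comm]
    have h6 : dist z b = infDist z AR := by rw [hbd]
    linarith
  have hnoedge : ∀ e ∈ edgePairs δ ω K, infDist (meshPoint δ e.1) AL ≤ δ →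
      infDist (meshPoint δ e.2) AR ≤ δ → False := by
    rintro e ⟨hadj, -, -⟩ hL hRt
    obtain ⟨a, ha, had⟩ := hALc.exists_infDist_eq_dist ⟨R.pt 0, h0AL (R.pt_mem_arc_self 0)⟩ (meshPoint δ e.1)
    obtain ⟨b, hb, hbd⟩ := hARc.exists_infDist_eq_dist ⟨R.pt 2, h2AR (R.pt_mem_arc_self 2)⟩ (meshPoint δ e.2)
    have h3 := hLR a ha b hb
    have hxy : dist (meshPoint δ e.1) (meshPoint δ e.2) = δ := by
      rw [dist_meshPoint_of_adj hadj, abs_of_pos hδ]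
    have h4 : dist a b ≤ dist a (meshPoint δ e.1) + dist (meshPoint δ e.1) (meshPoint δ e.2) +
        dist (meshPoint δ e.2) b := dist_triangle4 _ _ _ _
    have h5 : dist a (meshPoint δ e.1) = infDist (meshPoint δ e.1) AL := by rw [had, dist_comm]
    have h6 : dist (meshPoint δ e.2) b = infDist (meshPoint δ e.2) AR := by rw [hbd]
    linarith
  -- the graph of open edges drawn through `K`
  let G : SimpleGraph (Site 2) :=
    { Adj := fun x y => (x, y) ∈ edgePairs δ ω K
      symm := ⟨fun x y hxy => swap_mem_edgePairs hxy⟩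
      loopless := ⟨fun x hx => hx.1.ne rfl⟩ }
  have hG : ∀ x y, G.Adj x y ↔ (x, y) ∈ edgePairs δ ω K := fun _ _ => Iff.rfl
  -- edge pairs at the two outer sides of the band: both ends outside `Ω̄`, near `AL` / `AR`
  have hside : ∀ k ∈ K, k ∈ Sd → ∀ e ∈ edgePairs δ ω K, k ∈ segment ℝ (meshPoint δ e.1) (meshPoint δ e.2) →
      meshPoint δ e.1 ∉ R.carrier ∧ meshPoint δ e.2 ∉ R.carrier := by
    intro k hkK hkS e he hke
    obtain ⟨h1, h2⟩ := hseg_le he.1 k hke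
    constructor
    · intro hin
      have := hout k hkS _ (subset_closure hin)
      linarith
    · intro hin
      have := hout k hkS _ (subset_closure hin)
      linarith
  obtain ⟨k₀, hk₀K, hk₀s⟩ := hK0
  obtain ⟨k₂, hk₂K, hk₂s⟩ := hK2
  obtain ⟨e₀, he₀, hke₀⟩ := exists_mem_edgePairs_of_mem hKO hk₀K
  obtain ⟨e₂, he₂, hke₂⟩ := exists_mem_edgePairs_of_mem hKO hk₂K
  have hk₀S : k₀ ∈ Sd := by
    rw [side_zero_rq] at hk₀s
    obtain ⟨w, hw, rfl⟩ := hk₀s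
    exact mem_image_of_mem _ ⟨Or.inl hw.1, hw.2⟩
  have hk₂S : k₂ ∈ Sd := by
    rw [side_two_rq] at hk₂s
    obtain ⟨w, hw, rfl⟩ := hk₂s
    exact mem_image_of_mem _ ⟨Or.inr hw.1, hw.2⟩
  have hk₀AL : k₀ ∈ AL := by
    rw [side_zero_rq] at hk₀s
    obtain ⟨w, hw, rfl⟩ := hk₀s
    refine mem_image_of_mem _ ?_
    rw [mem_reProdIm, mem_Icc, mem_Icc]
    exact ⟨⟨by rw [hw.1]; linarith, by rw [hw.1]; linarith⟩, by linarith [hw.2.1], by linarith [hw.2.2]⟩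
  have hk₂AR : k₂ ∈ AR := by
    rw [side_two_rq] at hk₂s
    obtain ⟨w, hw, rfl⟩ := hk₂s
    refine mem_image_of_mem _ ?_
    rw [mem_reProdIm, mem_Icc, mem_Icc]
    exact ⟨⟨by rw [hw.1]; linarith, by rw [hw.1]; linarith⟩, by linarith [hw.2.1], by linarith [hw.2.2]⟩
  obtain ⟨he₀out, -⟩ := hside k₀ hk₀K hk₀S e₀ he₀ hke₀
  obtain ⟨he₂out, -⟩ := hside k₂ hk₂K hk₂S e₂ he₂ hke₂
  have he₀L : infDist (meshPoint δ e₀.1) AL ≤ δ :=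
    (infDist_le_dist_of_mem hk₀AL).trans (by rw [dist_comm]; exact (hseg_le he₀.1 k₀ hke₀).1)
  have he₂R : infDist (meshPoint δ e₂.1) AR ≤ δ :=
    (infDist_le_dist_of_mem hk₂AR).trans (by rw [dist_comm]; exact (hseg_le he₂.1 k₂ hke₂).1)
  -- the walk in `G` from `e₀.1` to `e₂.1`
  obtain ⟨W⟩ := reachable_of_mem_edgePairs hδ hKconn.isPreconnected hKc.isBounded hKO G hG he₀ he₂
  -- the "left" predicate
  set In : Set (Site 2) := {x : Site 2 | meshPoint δ x ∈ R.carrier} with hIn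
  let P : Site 2 → Prop := fun v =>
    (meshPoint δ v ∉ R.carrier ∧ infDist (meshPoint δ v) AL ≤ δ) ∨
    (∃ (u₀ u₁ : Site 2) (hu₁ : u₁ ∈ In) (hv : v ∈ In), (u₁, u₀) ∈ edgePairs δ ω K ∧
      meshPoint δ u₀ ∉ R.carrier ∧ infDist (meshPoint δ u₀) AL ≤ δ ∧
      ((openGraph ω).induce In).Reachable ⟨u₁, hu₁⟩ ⟨v, hv⟩)
  have hPstart : P e₀.1 := Or.inl ⟨he₀out, he₀L⟩
  have hPend : ¬ P e₂.1 := by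
    rintro (⟨-, hL⟩ | ⟨u₀, u₁, hu₁, hv, -⟩)
    · exact hnotboth _ hL he₂R
    · exact he₂out hv
  obtain ⟨a, b, hab, hPa, hPb⟩ := exists_adj_step_of_walk P W hPstart hPend
  have hab' : (a, b) ∈ edgePairs δ ω K := hab
  -- adjacency in the open graph induced on `In`
  have hopen : ∀ {x y : Site 2}, (x, y) ∈ edgePairs δ ω K → (openGraph ω).Adj x y := fun hxy =>
    (openGraph_adj _ _ _).2 ⟨hxy.2.1, hxy.1.ne⟩
  -- case analysis on `b`
  by_cases hbIn : meshPoint δ b ∈ R.carrier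
  · -- `b` inside: then `P b` would follow from `P a`
    exfalso
    apply hPb
    rcases hPa with ⟨haout, haL⟩ | ⟨u₀, u₁, hu₁, haIn, hu, hu₀out, hu₀L, hreach⟩
    · exact Or.inr ⟨a, b, hbIn, hbIn, swap_mem_edgePairs hab', haout, haL, SimpleGraph.Reachable.refl _⟩
    · refine Or.inr ⟨u₀, u₁, hu₁, hbIn, hu, hu₀out, hu₀L, hreach.trans ?_⟩
      have : ((openGraph ω).induce In).Adj ⟨a, haIn⟩ ⟨b, hbIn⟩ := hopen hab'
      exact this.reachable
  · -- `b` outside: it is near `AR` (not near `AL`, else `P b`), so `a` is inside and we are done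
    have hbR : infDist (meshPoint δ b) AR ≤ δ := by
      rcases houtside (a, b) hab' hbIn with hbL | hbR
      · exact absurd (Or.inl ⟨hbIn, hbL⟩) hPb
      · exact hbR
    rcases hPa with ⟨-, haL⟩ | ⟨u₀, u₁, hu₁, haIn, hu, hu₀out, hu₀L, hreach⟩
    · exact absurd hbR (fun hbR => hnoedge (a, b) hab' haL hbR)
    · refine ⟨u₁, hnear0 (u₁, u₀) hu hu₁ hu₀out hu₀L, a, hnear2 (a, b) hab' haIn hbIn hbR,
        hu₁, haIn, hreach⟩

end SquareModel

end Summit.CriticalPhenomena.CardyFormulaZ2.Theorems.MeckeFlipBridge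

end
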